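import Literature.AlgebraicGeometry.Motives.Differentials
import Mathlib.AlgebraicGeometry.AffineScheme
import Mathlib.RingTheory.Localization.Away.Basic
import HarnessLib

/-!
# The basic open `D(r) ⊆ 𝒳` of an `R`-scheme is an `R[1/r]`-scheme

Let `𝒳 → Spec R` be an `R`-scheme (`Over (Spec R)`, the tree's `SchemeOver R`) and `r ∈ R`. The open
subscheme `D(r) = 𝒳_r` where (the image of) `r` is invertible carries a canonical structure of
scheme over any localization `S = R[1/r]` (`IsLocalization.Away r S`): the ring map
`R → Γ(𝒳, ⊤) → Γ(𝒳, D(r))` inverts `r`, hence extends to `S → Γ(𝒳, D(r)) ≅ Γ(D(r), ⊤)`, and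
`D(r) → Spec Γ(D(r), ⊤) → Spec S` is the structure map (`baseBasicOpenOver`). We prove the two
compatibilities a user needs:

* `baseBasicOpenOver_hom_comp` — `D(r) → Spec S → Spec R` is the composite `D(r) ⊆ 𝒳 → Spec R`;
* `constToPresheaf_baseBasicOpen` — the structure morphism of presheaves of rings
  `R → 𝒪_{D(r)}` (the tree's `Motives.constToPresheaf`, the input of the algebraic de Rham complex
  `Crystalline.algebraicDeRhamComplex`) of `D(r)/R` is `R → S` followed by that of `D(r)/S`.

Everything is proved (Hartshorne II Ex. 2.4: `Hom(X, Spec A) = Hom(A, Γ(X, 𝒪_X))`; II Ex. 2.16: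
`X_f`). For `R = W(k)`, `r = p`, `S = K = W[1/p]` (`Motives/WittSchemeGenericFibre`:
`K = Frac W(k)` IS `W[1/p]`, and `D(p)` is the image of the generic fibre) this makes the open
subscheme `𝒳[1/p] ⊆ 𝒳` a `K`-scheme — the form in which the generic fibre enters the comparison of
`Ω•_{𝒳/W}` with `Ω•_{X_K/K}` around `Crystalline.HodgeDeRhamDegeneratesModTorsion`.

## References

* R. Hartshorne, *Algebraic Geometry*, GTM 52 (1977), II Ex. 2.4, Ex. 2.16. [Hartshorne1977]
* A. Grothendieck, J. Dieudonné, EGA I (1971), §1.6 (morphisms into affine schemes). [folklore]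
-/

noncomputable section

open CategoryTheory TopologicalSpace Opposite AlgebraicGeometry

universe u

namespace Literature.AlgebraicGeometry.Motives

variable {R S : Type u} [CommRing R] [CommRing S] [Algebra R S] (r : R) [IsLocalization.Away r S]
  (𝒳 : Over (Spec (CommRingCat.of R)))

/-- The structure ring homomorphism `R → Γ(𝒳, ⊤)` of an `R`-scheme `𝒳 → Spec R`
(`R ≅ Γ(Spec R) → Γ(𝒳, ⊤)`; the top component of `constToPresheaf 𝒳`). [folklore] -/
def toΓ : CommRingCat.of R ⟶ Γ(𝒳.left, ⊤) :=
  (Scheme.ΓSpecIso (CommRingCat.of R)).inv ≫ 𝒳.hom.appTop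

/-- The structure map factors through the canonical map to the spectrum of global sections:
`𝒳 → Spec R` is `𝒳 → Spec Γ(𝒳, ⊤) → Spec R` (the `Γ ⊣ Spec` adjunction, Hartshorne II Ex. 2.4).
[folklore] -/
theorem hom_eq_toSpecΓ : 𝒳.hom = 𝒳.left.toSpecΓ ≫ Spec.map (toΓ 𝒳) := by
  rw [toΓ, Spec.map_comp, ← Scheme.toSpecΓ_naturality_assoc, ← SpecMap_ΓSpecIso_hom,
    ← Spec.map_comp, Iso.inv_hom_id, Spec.map_id, Category.comp_id]

/-- The basic open `D(r) = 𝒳_r ⊆ 𝒳` of (the image in `Γ(𝒳, ⊤)` of) `r ∈ R` (Hartshorne II Ex. 2.16).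
[folklore] -/
def baseBasicOpen : 𝒳.left.Opens := 𝒳.left.basicOpen (toΓ 𝒳 r)

/-- `r` is invertible on `D(r)` (Mathlib `RingedSpace.isUnit_res_basicOpen`). [folklore] -/
theorem isUnit_map_baseBasicOpen :
    IsUnit ((toΓ 𝒳 ≫ 𝒳.left.presheaf.map (homOfLE le_top :
      baseBasicOpen r 𝒳 ⟶ ⊤).op) r) := by
  exact RingedSpace.isUnit_res_basicOpen _ (toΓ 𝒳 r)

/-- The ring homomorphism `R[1/r] → Γ(𝒳, D(r))` extending `R → Γ(𝒳, ⊤) → Γ(𝒳, D(r))`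
(universal property of the localization, Mathlib `IsLocalization.Away.lift`). [folklore] -/
def awayToΓ : CommRingCat.of S ⟶ Γ(𝒳.left, baseBasicOpen r 𝒳) :=
  CommRingCat.ofHom (IsLocalization.Away.lift r (g := (toΓ 𝒳 ≫ 𝒳.left.presheaf.map
    (homOfLE le_top : baseBasicOpen r 𝒳 ⟶ ⊤).op).hom) (isUnit_map_baseBasicOpen r 𝒳))

/-- `R → R[1/r] → Γ(𝒳, D(r))` is `R → Γ(𝒳, ⊤) → Γ(𝒳, D(r))`. [folklore] -/
theorem algebraMap_comp_awayToΓ :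
    CommRingCat.ofHom (algebraMap R S) ≫ awayToΓ r 𝒳 (S := S) =
      toΓ 𝒳 ≫ 𝒳.left.presheaf.map (homOfLE le_top : baseBasicOpen r 𝒳 ⟶ ⊤).op := by
  ext x
  simp only [awayToΓ, CommRingCat.hom_comp, CommRingCat.hom_ofHom, RingHom.coe_comp,
    Function.comp_apply, IsLocalization.Away.lift_eq]

/-- **`D(r) ⊆ 𝒳` is an `R[1/r]`-scheme**: the open subscheme `D(r)` with the structure map
`D(r) → Spec Γ(D(r), 𝒪) → Spec R[1/r]` (any `S` with `IsLocalization.Away r S`; for `𝒳` over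
`W(k)` and `r = p` this is the generic fibre `𝒳[1/p]` over `K = W[1/p]`,
cf. `Motives/WittSchemeGenericFibre`). [folklore] -/
def baseBasicOpenOver : Over (Spec (CommRingCat.of S)) :=
  Over.mk ((baseBasicOpen r 𝒳 : 𝒳.left.Opens).toScheme.toSpecΓ ≫
    Spec.map ((awayToΓ r 𝒳) ≫ (baseBasicOpen r 𝒳 : 𝒳.left.Opens).topIso.inv))

/-- The underlying scheme of `baseBasicOpenOver r 𝒳` is the open subscheme `D(r)` (by `rfl`).
[folklore] -/
theorem baseBasicOpenOver_left : (baseBasicOpenOver r 𝒳 (S := S)).left = ↑(baseBasicOpen r 𝒳) :=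
  rfl

/-- Ring-level compatibility of the two structures on `D(r)`:
`R → R[1/r] → Γ(𝒳, D(r)) ≅ Γ(D(r), ⊤)` equals `R → Γ(𝒳, ⊤) → Γ(D(r), ⊤)`. [folklore] -/
theorem algebraMap_comp_awayToΓ_comp_topIso_inv :
    CommRingCat.ofHom (algebraMap R S) ≫ awayToΓ r 𝒳 (S := S) ≫ (baseBasicOpen r 𝒳).topIso.inv =
      toΓ 𝒳 ≫ (baseBasicOpen r 𝒳).ι.appTop := by
  rw [reassoc_of% (algebraMap_comp_awayToΓ r 𝒳 (S := S)), Scheme.Opens.ι_appTop,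
    Scheme.Opens.topIso_inv]
  erw [← Functor.map_comp]
  rfl

/-- **Compatibility of the structure maps**: `D(r) → Spec R[1/r] → Spec R` is `D(r) ⊆ 𝒳 → Spec R`,
i.e. `D(r)/R[1/r]` restricts to the open subscheme `D(r)/R` of `𝒳/R`. [folklore] -/
theorem baseBasicOpenOver_hom_comp :
    (baseBasicOpenOver r 𝒳 (S := S)).hom ≫ Spec.map (CommRingCat.ofHom (algebraMap R S)) =
      (baseBasicOpen r 𝒳).ι ≫ 𝒳.hom := by
  rw [hom_eq_toSpecΓ 𝒳, Scheme.toSpecΓ_naturality_assoc, ← Spec.map_comp,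
    ← algebraMap_comp_awayToΓ_comp_topIso_inv r 𝒳 (S := S), Spec.map_comp, Spec.map_comp]
  simp only [baseBasicOpenOver, Over.mk_hom, Spec.map_comp, Category.assoc]
  rfl

/-- **The structure morphism `R → 𝒪_{D(r)}` of the `R`-scheme `D(r) ⊆ 𝒳 → Spec R` factors through
that of the `R[1/r]`-scheme `D(r) → Spec R[1/r]`**: `constToPresheaf` of the former is
`R → R[1/r]` followed by `constToPresheaf` of the latter (the input for comparing the de Rham
complexes `Ω•_{D(r)/R}` and `Ω•_{D(r)/R[1/r]}`). [folklore] -/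
theorem constToPresheaf_baseBasicOpen :
    constToPresheaf (Over.mk ((baseBasicOpen r 𝒳).ι ≫ 𝒳.hom)) =
      (Functor.const _).map (CommRingCat.ofHom (algebraMap R S)) ≫
        constToPresheaf (baseBasicOpenOver r 𝒳 (S := S)) := by
  ext V : 2
  rw [NatTrans.comp_app, Functor.const_map_app]
  change (Scheme.ΓSpecIso (.of R)).inv ≫ ((baseBasicOpen r 𝒳).ι ≫ 𝒳.hom).appTop ≫
      (baseBasicOpen r 𝒳).toScheme.presheaf.map (homOfLE le_top).op =
    CommRingCat.ofHom (algebraMap R S) ≫ (Scheme.ΓSpecIso (.of S)).inv ≫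
      ((baseBasicOpen r 𝒳).toScheme.toSpecΓ ≫
          Spec.map (awayToΓ r 𝒳 (S := S) ≫ (baseBasicOpen r 𝒳).topIso.inv)).appTop ≫
        (baseBasicOpen r 𝒳).toScheme.presheaf.map (homOfLE le_top).op
  rw [Scheme.Hom.comp_appTop, Scheme.Hom.comp_appTop, Scheme.toSpecΓ_appTop, Category.assoc,
    Category.assoc, ← Scheme.ΓSpecIso_inv_naturality_assoc, Iso.inv_hom_id_assoc, Category.assoc,
    reassoc_of% (algebraMap_comp_awayToΓ_comp_topIso_inv r 𝒳 (S := S)), toΓ, Category.assoc]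

end Literature.AlgebraicGeometry.Motives
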